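import Summits.SmoothPoincare4.SmoothPoincare4.Theorems.CylinderEntropyCylinderRungTwoFluxIdentity
import Summits.SmoothPoincare4.SmoothPoincare4.Theorems.CylinderEntropyCylinderRungTwoFarPointsJoined
import Summits.SmoothPoincare4.SmoothPoincare4.Theorems.CylinderEntropyCylinderRungTwoSidesDifferOfPocket
import HarnessLib

/-!
# Crossing parity over a non-separating cross-section of `S⁴ × ℝ` with a pocket

Registered helper `helper_crossingParityOfPocket` (wave 2, W2-1) of line `killing-flux` of the
crux `CylinderEntropy.CylinderRungTwo` (stmt-SmoothPoincare4-7631). Everything here is proved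
(no named facts); theorems only.

Let `N = {z ∈ ℝ⁶ | ∑_{i<5} zᵢ² = 1} = S⁴ × ℝ`, `M` a compact connected boundaryless `4`-manifold,
`ι : M → ℝ⁶` a smooth embedding with image in `N`, and `ν` a continuous unit normal field along `ι`
tangent to `N`. If `ι(M)` does NOT separate the two ends of `N` (for every `R` some point of height
`≤ -R` is joined in `N ∖ ι(M)` to some point of height `≥ R`) and `N ∖ ι(M)` has a *pocket* (a
point not joined in `N ∖ ι(M)` to any point of height `≤ -R₀`), then for `μH⁴`-a.e. `p ∈ S⁴` the
fibre `{x | truncL (ι x) = p}` of the shadow is a finite set `F`, regular (`ν₅ ≠ 0` on `F`), and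
the crossings of the vertical line over `p` are balanced:
`#{x ∈ F | ν₅ x > 0} = #{x ∈ F | ν₅ x < 0}`.

*Proof.* This is the degree-zero crossing count inside `helper_fluxZeroOfPocket`, exported in
`Finset` form. For `μHE⁴`-a.e. `p` the fibre is finite and regular (`ae_exists_finset_fibre`). For
such `p ∈ S⁴`, the telescoping count `low_sub_low_eq_sum` along the vertical line over `p` from
height `-R'` to height `R'` (`R'` above all heights of `ι(M)` and above `R₀`) reads
`[L(p,-R')] - [L(p,R')] = d · ∑_{x ∈ F} sign ν₅(x)`, `d = [a₋] - [a₊]`, where `L` is "joined in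
`N ∖ ι(M)` to a point of height `≤ -R₀`" and `a₊, a₋` are the side constants of the `±ν` push-offs
(`exists_side_constants`). Far below is lower (`low_of_le`); WITHOUT separation far above is ALSO
lower: non-separation at level `R'` gives `a, b ∈ N`, `a₅ ≤ -R'`, `R' ≤ b₅`, joined in `N ∖ ι(M)`,
and `(p, R')` is joined to `b` by `helper_farPointsJoined`. Hence `d · ∑ sign ν₅ = 0`; the pocket
gives `d ≠ 0` by `helper_sidesDifferOfPocket`, so the signed count vanishes, i.e. `N₊(p) = N₋(p)`.
Finally Mathlib's `μH⁴` is a scalar multiple of `μHE⁴` (`hausdorffMeasure_eq_smul_euclidean`), so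
the `μHE⁴`-a.e. statement is also `μH⁴`-a.e.
-/

-- the prescribed namespace `Summit.SmoothPoincare4.SmoothPoincare4.…` repeats `SmoothPoincare4`
set_option linter.dupNamespace false

noncomputable section

open MeasureTheory Set Function Filter Module
open scoped Manifold ContDiff ENNReal Topology RealInnerProductSpace NNReal

namespace Summit.SmoothPoincare4.SmoothPoincare4.Theorems.CylinderRungTwo.KillingFlux

open Literature.Geometry.Riemannian
open Literature.Geometry.Lorentzian Literature.Geometry.Lorentzian.PseudoRiemannianMetric
open Literature.Geometry.Riemannian.SphericalCylinderEntropy (truncL truncL_apply)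
open Literature.Geometry.Manifold.CylinderSlice (axis padL castSucc_ne_five)

/-- **W2-1: crossing parity with a pocket.** For a compact connected boundaryless `4`-manifold `M`,
a smooth embedding `ι : M → N = S⁴ × ℝ ⊂ ℝ⁶` whose image does not separate the two ends of `N` and
whose complement has a pocket, and any continuous unit normal field `ν` along `ι` tangent to `N`:
for `μH⁴`-a.e. `p ∈ S⁴` the fibre of the shadow `truncL ∘ ι` over `p` is a finite regular set `F`
(`ν₅ ≠ 0` on `F`) with as many upward as downward crossings,
`#{x ∈ F | 0 < ν₅ x} = #{x ∈ F | ν₅ x < 0}`. Degree-zero crossing count: along the vertical line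
over `p` both far ends are on the lower side (non-separation + `helper_farPointsJoined`), so
`d · (N₊(p) - N₋(p)) = 0` with `d = [a₋] - [a₊] ≠ 0` (pocket + `helper_sidesDifferOfPocket`).
[folklore] -/
theorem helper_crossingParityOfPocket : ∀ (M : Type) [TopologicalSpace M] [T2Space M] [SecondCountableTopology M] [ChartedSpace (EuclideanSpace ℝ (Fin 4)) M] [IsManifold (𝓡 4) ∞ M] [CompactSpace M] [ConnectedSpace M] [MeasurableSpace M] [BorelSpace M] (ι : M → EuclideanSpace ℝ (Fin 6)), Manifold.IsSmoothEmbedding (𝓡 4) (𝓡 6) ∞ ι → (∀ x, ∑ i : Fin 5, ι x (Fin.castSucc i) ^ 2 = 1) → (∀ R : ℝ, ∃ a b : EuclideanSpace ℝ (Fin 6), ∑ i : Fin 5, a (Fin.castSucc i) ^ 2 = 1 ∧ ∑ i : Fin 5, b (Fin.castSucc i) ^ 2 = 1 ∧ a 5 ≤ -R ∧ R ≤ b 5 ∧ JoinedIn ({z : EuclideanSpace ℝ (Fin 6) | ∑ i : Fin 5, z (Fin.castSucc i) ^ 2 = 1} \ Set.range ι) a b) → (∃ (z : EuclideanSpace ℝ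 (Fin 6)) (R : ℝ), ∑ i : Fin 5, z (Fin.castSucc i) ^ 2 = 1 ∧ z ∉ Set.range ι ∧ ∀ b : EuclideanSpace ℝ (Fin 6), ∑ i : Fin 5, b (Fin.castSucc i) ^ 2 = 1 → b 5 ≤ -R → ¬ JoinedIn ({z : EuclideanSpace ℝ (Fin 6) | ∑ i : Fin 5, z (Fin.castSucc i) ^ 2 = 1} \ Set.range ι) z b) → ∀ ν : M → EuclideanSpace ℝ (Fin 6), Continuous ν → (euclideanMetric (EuclideanSpace ℝ (Fin 6))).IsUnitNormal (𝓡 4) ι ν 1 → (∀ x, ∑ i : Fin 5, ν x (Fin.castSucc i) * ι x (Fin.castSucc i) = 0) → ∀ᵐ p ∂(μH[4] : Measure (EuclideanSpace ℝ (Fin 5))), p ∈ Metric.sphere (0 : EuclideanSpace ℝ (Fin 5)) 1 → ∃ F : Finset M, (∀ x, x ∈ F ↔ truncL (ι x) = p) ∧ (∀ x ∈ F, ν x 5 ≠ 0) ∧ (F.filter (fun x => 0 < ν x 5)).card = (F.filter (fun x => ν x 5 < 0)).card := by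
  intro M _ _ _ _ _ _ _ _ _ ι hι hιN hns hpk ν hνc hνn hνt
  obtain ⟨z, R, hzN, hzr, hpocket⟩ := hpk
  classical
  -- the two sides of the cross-section; with the pocket they differ (W1a)
  obtain ⟨t₀, ht₀, aP, aM, hPm, hMm⟩ := exists_side_constants hι hιN hνc hνn hνt R
  have hne : ¬ (aP ↔ aM) :=
    helper_sidesDifferOfPocket M ι ν hι hιN hνc hνn hνt R t₀ aP aM ht₀ hPm hMm ⟨z, hzN, hzr, hpocket⟩
  have hd0 : ((if aM then (1 : ℤ) else 0) - (if aP then (1 : ℤ) else 0)) ≠ 0 := by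
    by_cases haP : aP
    · by_cases haM : aM
      · exact absurd ⟨fun _ => haM, fun _ => haP⟩ hne
      · rw [if_neg haM, if_pos haP]; norm_num
    · by_cases haM : aM
      · rw [if_pos haM, if_neg haP]; norm_num
      · exact absurd ⟨fun h => absurd h haP, fun h => absurd h haM⟩ hne
  -- a bound on the heights of `ι(M)`
  have hιc : Continuous ι := hι.contMDiff.continuous
  have hcont : Continuous fun x => |ι x 5| :=
    continuous_abs.comp ((EuclideanSpace.proj (5 : Fin 6)).continuous.comp hιc)
  obtain ⟨B, hB⟩ := (isCompact_range hcont).bddAbove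
  have hB' : ∀ x, |ι x 5| ≤ B := fun x => hB ⟨x, rfl⟩
  have hB0 : 0 ≤ B := by
    obtain ⟨x₀⟩ := (inferInstance : Nonempty M)
    exact (abs_nonneg _).trans (hB' x₀)
  set R' : ℝ := max R B + 1 with hR'
  have hBR : B < R' := by rw [hR']; linarith [le_max_right R B]
  have hRR : R ≤ R' := by rw [hR']; linarith [le_max_left R B]
  -- WITHOUT separation, every point of `N` of height `≥ R'` is on the lower side (W2)
  have hAbove : ∀ w : EuclideanSpace ℝ (Fin 6), ∑ i : Fin 5, w (Fin.castSucc i) ^ 2 = 1 → R' ≤ w 5 →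
      (∃ b : EuclideanSpace ℝ (Fin 6), (∑ i : Fin 5, b (Fin.castSucc i) ^ 2 = 1) ∧ b (5 : Fin 6) ≤ -R ∧
        JoinedIn (({z : EuclideanSpace ℝ (Fin 6) | ∑ i : Fin 5, z (Fin.castSucc i) ^ 2 = 1} :
          Set (EuclideanSpace ℝ (Fin 6))) \ Set.range ι) w b) := by
    intro w hw hw5
    obtain ⟨a, b, ha, hb, ha5, hb5, hab⟩ := hns R'
    have hA : ∀ z ∈ range ι, |z 5| < R' := by
      rintro _ ⟨x, rfl⟩
      exact (hB' x).trans_lt hBR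
    have hwb := (helper_farPointsJoined (range ι) R' hA).1 w b hw hb hw5 hb5
    exact ⟨a, ha, by linarith, hwb.trans hab.symm⟩
  -- degree zero: over every `p ∈ S⁴` with finite regular fibre, `∑ sign ν₅ = 0`
  have hd : ∀ p : EuclideanSpace ℝ (Fin 5), ∑ i : Fin 5, p i ^ 2 = 1 → ∀ F : Finset M,
      (∀ x, x ∈ F ↔ truncL (ι x) = p) → (∀ x ∈ F, ν x 5 ≠ 0) →
      ∑ x ∈ F, (if 0 < ν x 5 then (1 : ℤ) else -1) = 0 := by
    intro p hp F hF hreg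
    have hfree : ∀ s : ℝ, B < |s| → padL p + s • (axis : (EuclideanSpace ℝ (Fin 6))) ∉ range ι := by
      intro s hs hmem
      obtain ⟨x, -, hxs⟩ := (vert_mem_range_iff ι p s).1 hmem
      have := hB' x
      rw [hxs] at this
      linarith
    have h₀ : padL p + (-R') • (axis : (EuclideanSpace ℝ (Fin 6))) ∉ range ι :=
      hfree _ (by rw [abs_neg, abs_of_pos] <;> linarith)
    have h₁ : padL p + R' • (axis : (EuclideanSpace ℝ (Fin 6))) ∉ range ι :=
      hfree _ (by rw [abs_of_pos] <;> linarith)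
    have key := low_sub_low_eq_sum hι hιN hνn hνt (fun x t ht => (hPm x t ht).2)
      (fun x t ht => (hMm x t ht).2) ht₀ hp hF hreg _ (-R') R' (by linarith) h₀ h₁ rfl
    -- all crossings lie between `-R'` and `R'`
    have hall : (F.filter fun x => -R' < ι x 5 ∧ ι x 5 < R') = F := by
      refine Finset.filter_true_of_mem fun x _ => ?_
      have := hB' x
      rw [abs_le] at this
      constructor <;> linarith
    rw [hall] at key
    -- far below AND far above are on the lower side
    have hlow : (∃ b : EuclideanSpace ℝ (Fin 6), (∑ i : Fin 5, b (Fin.castSucc i) ^ 2 = 1) ∧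
        b (5 : Fin 6) ≤ -R ∧
        JoinedIn (({z : EuclideanSpace ℝ (Fin 6) | ∑ i : Fin 5, z (Fin.castSucc i) ^ 2 = 1} :
          Set (EuclideanSpace ℝ (Fin 6))) \ Set.range ι)
          (padL p + (-R') • (axis : (EuclideanSpace ℝ (Fin 6)))) b) :=
      low_of_le ⟨vert_mem_Ncyl hp _, h₀⟩ (by rw [vert_apply_five]; linarith)
    have hup : (∃ b : EuclideanSpace ℝ (Fin 6), (∑ i : Fin 5, b (Fin.castSucc i) ^ 2 = 1) ∧
        b (5 : Fin 6) ≤ -R ∧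
        JoinedIn (({z : EuclideanSpace ℝ (Fin 6) | ∑ i : Fin 5, z (Fin.castSucc i) ^ 2 = 1} :
          Set (EuclideanSpace ℝ (Fin 6))) \ Set.range ι)
          (padL p + R' • (axis : (EuclideanSpace ℝ (Fin 6)))) b) :=
      hAbove _ (vert_mem_Ncyl hp _) (by rw [vert_apply_five])
    rw [if_pos hlow, if_pos hup, sub_self] at key
    exact (mul_eq_zero.1 key.symm).resolve_left hd0
  -- a.e. on `ℝ⁵` w.r.t. `μHE⁴`: finite regular fibre with balanced crossings
  have hae : ∀ᵐ p ∂(μHE[4] : Measure (EuclideanSpace ℝ (Fin 5))),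
      p ∈ Metric.sphere (0 : EuclideanSpace ℝ (Fin 5)) 1 → ∃ F : Finset M,
        (∀ x, x ∈ F ↔ truncL (ι x) = p) ∧ (∀ x ∈ F, ν x 5 ≠ 0) ∧
          (F.filter (fun x => 0 < ν x 5)).card = (F.filter (fun x => ν x 5 < 0)).card := by
    filter_upwards [ae_exists_finset_fibre hι hιN hνc hνn hνt] with p hpF hpS
    obtain ⟨F, hFmem, hreg⟩ := hpF
    have hp : ∑ i : Fin 5, p i ^ 2 = 1 :=
      Literature.Geometry.Manifold.CylinderSlice.sum_sq_eq_one ⟨p, hpS⟩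
    have key := hd p hp F hFmem hreg
    rw [Finset.sum_ite, Finset.sum_const, Finset.sum_const, nsmul_eq_mul, nsmul_eq_mul, mul_one,
      mul_neg, mul_one] at key
    have hfilt : (F.filter fun x => ¬ 0 < ν x 5) = F.filter fun x => ν x 5 < 0 :=
      Finset.filter_congr fun x hx => ⟨fun h => lt_of_le_of_ne (not_lt.1 h) (hreg x hx),
        fun h => not_lt.2 h.le⟩
    rw [hfilt] at key
    exact ⟨F, hFmem, hreg, by omega⟩
  -- convert `μH ↔ μHE`: `μH⁴` is a scalar multiple of `μHE⁴`
  rw [hausdorffMeasure_eq_smul_euclidean (X := (EuclideanSpace ℝ (Fin 5)))]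
  exact Measure.ae_smul_measure hae _

end Summit.SmoothPoincare4.SmoothPoincare4.Theorems.CylinderRungTwo.KillingFlux

end
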